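import Literature.AlgebraicGeometry.Frobenioids.ArchimedeanPerfectionDiscs
import Literature.AlgebraicGeometry.Frobenioids.Thm36SubPerfectionUnits
import Literature.AlgebraicGeometry.Frobenioids.PerfectionBiratCommuteEquiv
import Literature.AlgebraicGeometry.Frobenioids.BiratUnitsDiv
import HarnessLib

/-!
# Frobenioids II, Thm. 3.6 (i) at `Λ = ℚ` («rational function monoid ≅ (Φ^fld)^Λ»), piece P2 / FILE A:
# the STANDARD GERMS of `O^×((A, n)^birat)` in `C^ℚ := C^pf` and their divisors — a multiplicative
# section of the divisor map over the scalars `K^×`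

Mochizuki, *The geometry of Frobenioids II: poly-Frobenioids*, Kyushu J. Math. **62** (2008) 401–460, §3,
Thm. 3.6 (i), kurims p. 36 l. 34–35 [cite: MochizukiFrdII2008, Thm 3.6 (i) p.36]: "The Frobenioid `(C^Λ)^istr`
is of isotropic, base-trivial, and model type, with rational function monoid naturally isomorphic to
`(Φ^fld)^Λ`" — here `Λ = ℚ`, `C^ℚ := C^pf` (Ex. 3.3 (ii) p. 28), `Φ^fld(Spec K) = Φ^gp × O_K^× ≅ K^×`
(p. 36 l. 29–33); [FrdI] Prop. 4.4 (i)/(ii)/(iv) p. 82–84 for `O^×(A^birat)` ("rational functions") and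
its divisor map [cite: MochizukiFrdI2008, Prop. 4.4 p.82].

abc-iut cell, layer L1, row M13-c3 (L1-lead R113/R114), piece **P2 FILE A** of abc-iut-L1-t6's DESIGN
(HOME/staging/L1/L1-t6/g3/M13-c3-DESIGN.md; seat abc-iut-w5-d246).  For `X = (A, n)` an object of THE
perfection `C^pf` (abc-iut-L1-d9, `PreFrobenioid.Perfection hF`) of the archimedean Frobenioid
`C = C₀ ×_{D₀} D → F_Φ` (Ex. 3.3 (ii)) and a Frobenius level `c` at which `A^{(c)}` is naively isotropic
(such levels are cofinal, abc-iut-w4-d074's `Thm36Sub.exists_isotropic_levels`, [FrdII] Lem. 3.2 (v)):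

* (file 1, `ArchimedeanPerfectionDiscs.lean`: the discs `disc B t` over an object `B` of `C` and the scalar
  arrows `discIncl : disc B t → B`, co-angular pre-steps of `C` with `Div = log(tip/(|z|·t))`;)
* `stdFrac` / `germ` — the STANDARD GERM of scalar `z` at `X`: the class in
  `O^×(X^birat) = PreFrobenioid.BiratUnits (pfStr π hF) hPf X` (abc-iut-L1-t10's rational functions,
  [FrdI] Prop. 4.4 (iv): pairs of base-equivalent co-angular pre-steps modulo refinement) of the pair
  `(disc → A^{(c)} with scalar 1, disc → A^{(c)} with scalar z)`, read in `C^pf` at level `(1, c)` (the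
  lifting pattern of abc-iut-w4-d044's `PerfectionBiratCommuteEquiv.lean`);
* `germ_eq_germ` (independence of the radius), **`germ_mul`** (`germ z · germ z' = germ (z z')`: products
  of germs are computed on a common refinement, [FrdI] Prop. 4.4 (i) p. 84, which here is a smaller disc),
  `germ_one`, the homomorphism **`germHom : K^× →* O^×(X^birat)`**;
* **`divHom_germ`** — the divisor ([FrdI] Prop. 4.4 (i): `(φ^*)⁻¹Div φ − (α^*)⁻¹Div α`, abc-iut-L1-t10's
  `BiratUnits.divHom`) of the standard germ of scalar `z`: the class of `−log |z|` at index `n·c` in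
  `Φ^pf(A)^gp` (made of the two perfected divisors `log(tip/(|z|·t))`, `log(tip/t)` of Ex. 3.3 (i) p. 28,
  "`Div(φ) := log(λ)`").

Route (R) of the P2 SIZING (05:15Z): together with the landed exact sequence
`1 → O^×(X) → O^×(X^birat) → Φ^gp` (`BiratUnits.unitsToBirat_injective`, `BiratUnits.ker_divHom_eq_range`)
these give a multiplicative SECTION of the divisor map; FILE B (successor) assembles
`O^×(X^birat) ≅ (Φ^fld(K))^pf`.  Data-level `def`s only (objects, arrows, germs); no `def … : Prop`;
nothing here bears on [IUTchIII] Cor. 3.12.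
-/

noncomputable section

namespace Literature.AlgebraicGeometry.Frobenioids

open CategoryTheory Opposite
open scoped Pointwise NNReal

universe v u

namespace ArchFrd

namespace Thm36Sub


variable {D : Type u} [Category.{v} D] {π : D ⥤ D0}

/-! ### The standard germs of `O^×((A, n)^birat)` in `C^pf` -/

section Germs

variable {hF : PreFrobenioid.IsFrobenioid (C.toElem π)} (X : pfCat π hF)

open PreFrobenioid PreFrobenioid.Perfection

/-- The pull-back maps of the divisor monoid `Φ = ℝ_{≥0}` of `C` are identities (a constant monoid).
[cite: MochizukiFrdII2008, Ex 3.3 (i) p.28] -/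
@[simp] theorem pull_Φ {E E' : D} (f : E' ⟶ E) (x : (Φ π).obj (op E)) : pull (Φ π) f x = x := rfl

/-- The inverse of the chosen degree-one Frobenius arrow `S → S^{(1)}` (an isomorphism, Def. 1.3 (ii)).
[cite: MochizukiFrdI2008, Def. 1.3 (ii) p.24] -/
abbrev frobOneInv (S : C π) : frobPow hF S 1 ⟶ S :=
  CategoryTheory.inv (frob hF S 1) (I := Perfection.isIso_frob_one (hF := hF) S)

/-- `frob_S ≫ frob_S⁻¹ = id`. [cite: MochizukiFrdI2008, Def. 1.3 (ii) p.24] -/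
@[reassoc (attr := simp)] theorem frob_frobOneInv (S : C π) : frob hF S 1 ≫ frobOneInv (hF := hF) S = 𝟙 _ := by
  haveI := Perfection.isIso_frob_one (hF := hF) S
  exact IsIso.hom_inv_id _

/-- `frob_S⁻¹ ≫ frob_S = id`. [cite: MochizukiFrdI2008, Def. 1.3 (ii) p.24] -/
@[reassoc (attr := simp)] theorem frobOneInv_frob (S : C π) : frobOneInv (hF := hF) S ≫ frob hF S 1 = 𝟙 _ := by
  haveI := Perfection.isIso_frob_one (hF := hF) S
  exact IsIso.inv_hom_id _

/-- **The standard source `(disc A^{(c)} t, n·c)`** of the germs at `X = (A, n)`, level `c`, radius `t`: an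
object of `C^pf` over the Frobenius power `A^{(c)}`. [cite: MochizukiFrdI2008, Def. 3.1 (iii) p.57] -/
@[reducible] def discPf (c : ℕ+) (t : PosReal) : pfCat π hF := ⟨disc (frobPow hF X.obj c) t, X.idx * c⟩

/-- The representative, at level `(1, c)`, of the arrow `(disc, n·c) → (A, n)` of `C^pf` induced by an arrow
`ι : disc → A^{(c)}` of `C`: `frob_disc⁻¹ ≫ ι` (Def. 3.1 (iii); the lifting pattern of Prop. 5.5 (ii)).
[cite: MochizukiFrdI2008, Def. 3.1 (iii) p.57] -/
def inclRep (c : ℕ+) (t : PosReal) (ι : disc (frobPow hF X.obj c) t ⟶ frobPow hF X.obj c) :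
    Rep (discPf X c t) X :=
  ⟨⟨1, c, mul_one _⟩, frobOneInv (disc (frobPow hF X.obj c) t) ≫ ι⟩

/-- The arrow `(disc, n·c) → (A, n)` of `C^pf` induced by `ι : disc → A^{(c)}`.
[cite: MochizukiFrdI2008, Def. 3.1 (iii) p.57] -/
def inclHom (c : ℕ+) (t : PosReal) (ι : disc (frobPow hF X.obj c) t ⟶ frobPow hF X.obj c) : discPf X c t ⟶ X :=
  Hom.mk (inclRep X c t ι)

/-- An arrow of `C^pf` induced by a co-angular pre-step `ι` of `C` is a co-angular pre-step of `C^pf`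
(Prop. 3.2 (ii); abc-iut-w4-d044's `PerfectionBirat.isCoAngularPreStep_mk_of`). [cite: MochizukiFrdI2008, Prop. 3.2 (ii) p.59] -/
theorem isCoAngularPreStep_inclHom (c : ℕ+) (t : PosReal) {ι : disc (frobPow hF X.obj c) t ⟶ frobPow hF X.obj c}
    (hι : PreFrobenioid.IsCoAngularPreStep (C.toElem π) ι) :
    PreFrobenioid.IsCoAngularPreStep (pfStr π hF) (inclHom X c t ι) := by
  haveI := Perfection.isIso_frob_one (hF := hF) (disc (frobPow hF X.obj c) t)
  have h' : PreFrobenioid.IsCoAngularPreStep (C.toElem π) (frobOneInv (hF := hF) (disc (frobPow hF X.obj c) t) ≫ ι) :=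
    PreFrobenioid.IsCoAngularPreStep.iso_comp (F := C.toElem π) (CategoryTheory.inv (frob hF (disc (frobPow hF X.obj c) t) 1)) hι
  exact PerfectionBirat.isCoAngularPreStep_mk_of (inclRep X c t ι) h'

/-- `Base` of the induced arrow only depends on `Base(ι)`: it is `Base(ι) ≫ Base(frob_A,c)⁻¹`.
[cite: MochizukiFrdI2008, Prop. 3.2 (i) p.58] -/
theorem base_inclHom (c : ℕ+) (t : PosReal) (ι : disc (frobPow hF X.obj c) t ⟶ frobPow hF X.obj c) :
    PreFrobenioid.Base (pfStr π hF) (inclHom X c t ι) =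
      PreFrobenioid.Base (C.toElem π) ι ≫ baseInvFrob hF X.obj c := by
  haveI := Perfection.isIso_frob_one (hF := hF) (disc (frobPow hF X.obj c) t)
  change Rep.baseMap (inclRep X c t ι) = _
  unfold Rep.baseMap inclRep
  dsimp only
  simp only [PreFrobenioid.base_comp, ← Category.assoc]
  rw [← PreFrobenioid.base_comp (F := C.toElem π) (frob hF _ 1) (frobOneInv _), frob_frobOneInv,
    PreFrobenioid.base_id, Category.id_comp]


/-! ### Arrows between the standard sources and their composites with the germ arrows -/

/-- The arrow `(disc t, n·c) → (disc t', n·c)` of `C^pf` induced, at level `(1, 1)`, by an arrow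
`j : disc t → disc t'` of `C`: `frob⁻¹ ≫ j ≫ frob`. [cite: MochizukiFrdI2008, Def. 3.1 (iii) p.57] -/
def discHomPf (c : ℕ+) {t t' : PosReal} (j : disc (frobPow hF X.obj c) t ⟶ disc (frobPow hF X.obj c) t') :
    discPf X c t ⟶ discPf X c t' :=
  Hom.mk ⟨⟨1, 1, rfl⟩, frobOneInv (disc (frobPow hF X.obj c) t) ≫ j ≫ frob hF (disc (frobPow hF X.obj c) t') 1⟩

/-- The induced arrow of a co-angular pre-step `j` of `C` is a co-angular pre-step of `C^pf`.
[cite: MochizukiFrdI2008, Prop. 3.2 (ii) p.59] -/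
theorem isCoAngularPreStep_discHomPf (c : ℕ+) {t t' : PosReal}
    {j : disc (frobPow hF X.obj c) t ⟶ disc (frobPow hF X.obj c) t'}
    (hj : PreFrobenioid.IsCoAngularPreStep (C.toElem π) j) :
    PreFrobenioid.IsCoAngularPreStep (pfStr π hF) (discHomPf X c j) := by
  haveI := Perfection.isIso_frob_one (hF := hF) (disc (frobPow hF X.obj c) t)
  haveI := Perfection.isIso_frob_one (hF := hF) (disc (frobPow hF X.obj c) t')
  have h' : PreFrobenioid.IsCoAngularPreStep (C.toElem π)
      (frobOneInv (hF := hF) (disc (frobPow hF X.obj c) t) ≫ j ≫ frob hF (disc (frobPow hF X.obj c) t') 1) :=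
    PreFrobenioid.IsCoAngularPreStep.iso_comp (F := C.toElem π)
      (CategoryTheory.inv (frob hF (disc (frobPow hF X.obj c) t) 1)) (hj.comp_iso _)
  exact PerfectionBirat.isCoAngularPreStep_mk_of _ h'

/-- **Composition rule**: `(frob⁻¹ ≫ j ≫ frob) ≫ (frob⁻¹ ≫ ι) = frob⁻¹ ≫ (j ≫ ι)` in `C^pf` (composition at the
triple level `(1, 1, c)`, Def. 3.1 (iii)). [cite: MochizukiFrdI2008, Def. 3.1 (iii) p.57] -/
theorem discHomPf_comp_inclHom (c : ℕ+) {t t' : PosReal}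
    (j : disc (frobPow hF X.obj c) t ⟶ disc (frobPow hF X.obj c) t')
    (ι : disc (frobPow hF X.obj c) t' ⟶ frobPow hF X.obj c) :
    discHomPf X c j ≫ inclHom X c t' ι = inclHom X c t (j ≫ ι) := by
  let T : Level₃ (discPf X c t) (discPf X c t') X := ⟨1, 1, c, rfl, mul_one _⟩
  rw [discHomPf, inclHom, inclHom, Perfection.mk_comp_mk,
    ← Perfection.mk_compAt T _ _ (Level.le_rfl _) (Level.le_rfl _)]
  refine Perfection.Hom.mk_eq_mk.mpr ⟨T.out, Level.le_rfl _, Level.le_rfl _, ?_⟩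
  unfold compAt inclRep
  change Level.lift (⟨1, c, mul_one _⟩ : Level (discPf X c t) X) ⟨1, c, mul_one _⟩ (Level.le_rfl _)
      (Level.lift (⟨1, 1, rfl⟩ : Level (discPf X c t) (discPf X c t')) ⟨1, 1, rfl⟩ (Level.le_rfl _)
          (frobOneInv (disc (frobPow hF X.obj c) t) ≫ j ≫ frob hF (disc (frobPow hF X.obj c) t') 1) ≫
        Level.lift (⟨1, c, mul_one _⟩ : Level (discPf X c t') X) ⟨1, c, mul_one _⟩ (Level.le_rfl _)
          (frobOneInv (disc (frobPow hF X.obj c) t') ≫ ι)) =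
    Level.lift (⟨1, c, mul_one _⟩ : Level (discPf X c t) X) ⟨1, c, mul_one _⟩ (Level.le_rfl _)
      (frobOneInv (disc (frobPow hF X.obj c) t) ≫ j ≫ ι)
  rw [Level.lift_rfl, Level.lift_rfl, Level.lift_rfl, Level.lift_rfl]
  simp only [Category.assoc, frob_frobOneInv_assoc]


/-! ### The standard fractions and germs -/

section Std

variable (hPf : PreFrobenioid.IsFrobenioid (pfStr π hF)) (c : ℕ+)
  (hc : (frobPow hF X.obj c).fst.IsNaivelyIsotropic)

/-- `|1| · t ≤ tip` from `t ≤ tip` (the scalar-`1` arrow `disc_t → B` exists for `t ≤ tip(B)`).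
[cite: MochizukiFrdII2008, Ex 3.3 (i) p.27] -/
theorem norm_one_mul_le {t T : ℝ} (ht : t ≤ T) : ‖((1 : ℂˣ) : ℂ)‖ * t ≤ T := by
  rwa [Units.val_one, norm_one, one_mul]

/-- **The standard fraction of scalar `z` at `X = (A, n)`, level `c`, radius `t`**: the pair of co-angular
pre-steps `(disc_t, n·c) → (A, n)` of `C^pf` induced by the scalar arrows `disc_t → A^{(c)}` with scalars `1`
(denominator) and `z` (numerator) — a "rational function" at `X` in the sense of [FrdI] Prop. 4.4 (iv)
(abc-iut-L1-t10's `PreFrobenioid.RatFrac`). [cite: MochizukiFrdI2008, Prop. 4.4 (iv) p.83] -/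
def stdFrac (t : PosReal) (ht : (t : ℝ) ≤ (frobPow hF X.obj c).fst.tip) (z : ℂˣ)
    (hz : z ∈ D0.scalars (frobPow hF X.obj c).fst.base) (h : ‖(z : ℂ)‖ * t ≤ (frobPow hF X.obj c).fst.tip) :
    RatFrac (pfStr π hF) X where
  src := discPf X c t
  den := inclHom X c t (discIncl _ hc t 1 (one_mem _) (norm_one_mul_le ht))
  num := inclHom X c t (discIncl _ hc t z hz h)
  den_mem := isCoAngularPreStep_inclHom X c t (isCoAngularPreStep_discIncl hc t 1 (one_mem _) (norm_one_mul_le ht))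
  num_mem := isCoAngularPreStep_inclHom X c t (isCoAngularPreStep_discIncl hc t z hz h)
  baseEq := by
    change PreFrobenioid.Base (pfStr π hF) _ = PreFrobenioid.Base (pfStr π hF) _
    rw [base_inclHom, base_inclHom]
    rfl

variable {c}

include hPf

/-- **Independence of the radius (monotone case)**: for `t ≤ t'` the standard fractions of scalar `z` at radii
`t`, `t'` are refinement-related (refine along the inclusion `disc_t → disc_{t'}`; [FrdI] Prop. 4.4: equality in
`lim_→ Hom_C(A′, A)`). [cite: MochizukiFrdI2008, Prop. 4.4 p.82] -/
theorem stdFrac_rel_of_le {t t' : PosReal} (htt' : (t : ℝ) ≤ t') (ht : (t : ℝ) ≤ (frobPow hF X.obj c).fst.tip)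
    (ht' : (t' : ℝ) ≤ (frobPow hF X.obj c).fst.tip) (z : ℂˣ) (hz : z ∈ D0.scalars (frobPow hF X.obj c).fst.base)
    (h : ‖(z : ℂ)‖ * t ≤ (frobPow hF X.obj c).fst.tip) (h' : ‖(z : ℂ)‖ * t' ≤ (frobPow hF X.obj c).fst.tip) :
    RatFrac.Rel (stdFrac X c hc t ht z hz h) (stdFrac X c hc t' ht' z hz h') := by
  have hj : ‖((1 : ℂˣ) : ℂ)‖ * t ≤ (t' : ℝ) := norm_one_mul_le htt'
  refine ⟨discPf X c t, 𝟙 _, discHomPf X c (discIncl _ (isNaivelyIsotropic_disc _ t') t 1 (one_mem _) hj),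
    isCoAngularPreStep_id hPf _, ?_, ?_, ?_⟩
  · exact isCoAngularPreStep_discHomPf X c
      (isCoAngularPreStep_discIncl (isNaivelyIsotropic_disc _ t') t 1 (one_mem _) hj)
  · change 𝟙 (discPf X c t) ≫ inclHom X c t _ = discHomPf X c _ ≫ inclHom X c t' _
    rw [Category.id_comp, discHomPf_comp_inclHom, discIncl_comp_discIncl hc (one_mem _) (one_mem _) hj
      (norm_one_mul_le ht') (by rw [mul_one]; exact norm_one_mul_le ht)]
    exact congrArg (inclHom X c t) (discIncl_congr (mul_one _).symm)
  · change 𝟙 (discPf X c t) ≫ inclHom X c t _ = discHomPf X c _ ≫ inclHom X c t' _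
    rw [Category.id_comp, discHomPf_comp_inclHom,
      discIncl_comp_discIncl hc (one_mem _) hz hj h' (by rw [mul_one]; exact h)]
    exact congrArg (inclHom X c t) (discIncl_congr (mul_one _).symm)


/-- **Independence of the radius**: the class in `O^×(X^birat)` of the standard fraction of scalar `z` does not
depend on the radius of the source disc. [cite: MochizukiFrdI2008, Prop. 4.4 p.82] -/
theorem mk_stdFrac_eq_mk_stdFrac {t t' : PosReal} (ht : (t : ℝ) ≤ (frobPow hF X.obj c).fst.tip)
    (ht' : (t' : ℝ) ≤ (frobPow hF X.obj c).fst.tip) (z : ℂˣ) (hz : z ∈ D0.scalars (frobPow hF X.obj c).fst.base)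
    (h : ‖(z : ℂ)‖ * t ≤ (frobPow hF X.obj c).fst.tip) (h' : ‖(z : ℂ)‖ * t' ≤ (frobPow hF X.obj c).fst.tip) :
    BiratUnits.mk hPf (stdFrac X c hc t ht z hz h) = BiratUnits.mk hPf (stdFrac X c hc t' ht' z hz h') := by
  rcases le_total (t : ℝ) t' with htt' | htt'
  · exact BiratUnits.sound (stdFrac_rel_of_le X hPf hc htt' ht ht' z hz h h')
  · exact (BiratUnits.sound (stdFrac_rel_of_le X hPf hc htt' ht' ht z hz h' h)).symm

/-- **The standard fraction of scalar `1` is trivial**: `(α, α)` is the unit of `O^×(X^birat)` ([FrdI] Prop. 4.4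
(i), the class of `(id, id)`). [cite: MochizukiFrdI2008, Prop. 4.4 (i) p.84] -/
theorem mk_stdFrac_one (t : PosReal) (ht : (t : ℝ) ≤ (frobPow hF X.obj c).fst.tip)
    (h : ‖((1 : ℂˣ) : ℂ)‖ * t ≤ (frobPow hF X.obj c).fst.tip) :
    BiratUnits.mk hPf (stdFrac X c hc t ht 1 (one_mem _) h) = 1 := by
  rw [BiratUnits.one_def]
  refine BiratUnits.sound ⟨discPf X c t, 𝟙 _, (stdFrac X c hc t ht 1 (one_mem _) h).den,
    isCoAngularPreStep_id hPf _, (stdFrac X c hc t ht 1 (one_mem _) h).den_mem, ?_, ?_⟩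
  · change 𝟙 (discPf X c t) ≫ inclHom X c t _ = inclHom X c t _ ≫ 𝟙 X
    rw [Category.id_comp, Category.comp_id]
  · change 𝟙 (discPf X c t) ≫ inclHom X c t _ = inclHom X c t _ ≫ 𝟙 X
    rw [Category.id_comp, Category.comp_id]

/-- **Products of standard fractions** ([FrdI] Prop. 4.4 (i) p. 84: the composite in `C^birat` is computed on a
common refinement — here the disc of a small radius `r`, along the scalar arrows `1 : disc_r → disc_{t'}` and
`z' : disc_r → disc_t`): the product of the classes of scalars `z`, `z'` is the class of scalar `z · z'`.
[cite: MochizukiFrdI2008, Prop. 4.4 (i) p.84] -/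
theorem mk_stdFrac_mul_mk_stdFrac {t t' r : PosReal} (ht : (t : ℝ) ≤ (frobPow hF X.obj c).fst.tip)
    (ht' : (t' : ℝ) ≤ (frobPow hF X.obj c).fst.tip) (z z' : ℂˣ)
    (hz : z ∈ D0.scalars (frobPow hF X.obj c).fst.base) (hz' : z' ∈ D0.scalars (frobPow hF X.obj c).fst.base)
    (h : ‖(z : ℂ)‖ * t ≤ (frobPow hF X.obj c).fst.tip) (h' : ‖(z' : ℂ)‖ * t' ≤ (frobPow hF X.obj c).fst.tip)
    (hrt' : (r : ℝ) ≤ t') (hzr : ‖(z' : ℂ)‖ * r ≤ t) (hr : (r : ℝ) ≤ (frobPow hF X.obj c).fst.tip)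
    (hzz' : ‖((z * z' : ℂˣ) : ℂ)‖ * r ≤ (frobPow hF X.obj c).fst.tip) :
    BiratUnits.mk hPf (stdFrac X c hc t ht z hz h) * BiratUnits.mk hPf (stdFrac X c hc t' ht' z' hz' h') =
      BiratUnits.mk hPf (stdFrac X c hc r hr (z * z') (mul_mem hz hz') hzz') := by
  have h1r : ‖((1 : ℂˣ) : ℂ)‖ * r ≤ (t' : ℝ) := norm_one_mul_le hrt'
  have hzrT : ‖(z' : ℂ)‖ * r ≤ (frobPow hF X.obj c).fst.tip := hzr.trans ht
  let R : RatFrac.Refinement (stdFrac X c hc t' ht' z' hz' h') (stdFrac X c hc t ht z hz h) :=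
    { apex := discPf X c r
      left := discHomPf X c (discIncl _ (isNaivelyIsotropic_disc _ t') r 1 (one_mem _) h1r)
      right := discHomPf X c (discIncl _ (isNaivelyIsotropic_disc _ t) r z' hz' hzr)
      left_mem := isCoAngularPreStep_discHomPf X c
        (isCoAngularPreStep_discIncl (isNaivelyIsotropic_disc _ t') r 1 (one_mem _) h1r)
      right_mem := isCoAngularPreStep_discHomPf X c
        (isCoAngularPreStep_discIncl (isNaivelyIsotropic_disc _ t) r z' hz' hzr)
      w := by
        change discHomPf X c _ ≫ inclHom X c t' _ = discHomPf X c _ ≫ inclHom X c t _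
        rw [discHomPf_comp_inclHom, discHomPf_comp_inclHom,
          discIncl_comp_discIncl hc (one_mem _) hz' h1r h' (by rw [mul_one]; exact hzrT),
          discIncl_comp_discIncl hc hz' (one_mem _) hzr (norm_one_mul_le ht) (by rw [one_mul]; exact hzrT)]
        exact congrArg (inclHom X c r) (discIncl_congr ((mul_one z').trans (one_mul z').symm)) }
  rw [BiratUnits.mk_mul_mk_eq _ _ R]
  refine BiratUnits.sound ⟨discPf X c r, 𝟙 _, 𝟙 _, isCoAngularPreStep_id hPf _, isCoAngularPreStep_id hPf _,
    ?_, ?_⟩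
  · change 𝟙 (discPf X c r) ≫ (discHomPf X c _ ≫ inclHom X c t' _) = 𝟙 (discPf X c r) ≫ inclHom X c r _
    rw [discHomPf_comp_inclHom, discIncl_comp_discIncl hc (one_mem _) (one_mem _) h1r (norm_one_mul_le ht')
      (by rw [mul_one]; exact norm_one_mul_le hr)]
    exact congrArg (fun ι => 𝟙 (discPf X c r) ≫ inclHom X c r ι) (discIncl_congr (mul_one 1))
  · change 𝟙 (discPf X c r) ≫ (discHomPf X c _ ≫ inclHom X c t _) = 𝟙 (discPf X c r) ≫ inclHom X c r _
    rw [discHomPf_comp_inclHom, discIncl_comp_discIncl hc hz' hz hzr h hzz']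


/-- **The standard germ of scalar `z ∈ K^×` at `X = (A, n)`** (level `c`): the class in `O^×(X^birat)` of the
standard fraction of scalar `z` at the canonical radius — the rational function "multiplication by `z`" on
`A^{(c)}` read in `C^pf` ([FrdI] Prop. 4.4 (iv); [FrdII] Thm. 3.6 (i): `K^× = Φ^fld(K)` is the rational function
monoid). [cite: MochizukiFrdII2008, Thm 3.6 (i) p.36] -/
def germ (z : ℂˣ) (hz : z ∈ D0.scalars (frobPow hF X.obj c).fst.base) : BiratUnits (pfStr π hF) hPf X :=
  BiratUnits.mk hPf (stdFrac X c hc (rad (frobPow hF X.obj c) z) (rad_le (frobPow hF X.obj c) z) z hz (norm_mul_rad_le (frobPow hF X.obj c) z))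

/-- The germ is the class of the standard fraction at ANY admissible radius.
[cite: MochizukiFrdI2008, Prop. 4.4 p.82] -/
theorem germ_eq_mk_stdFrac (z : ℂˣ) (hz : z ∈ D0.scalars (frobPow hF X.obj c).fst.base) (t : PosReal)
    (ht : (t : ℝ) ≤ (frobPow hF X.obj c).fst.tip) (h : ‖(z : ℂ)‖ * t ≤ (frobPow hF X.obj c).fst.tip) :
    germ X hPf hc z hz = BiratUnits.mk hPf (stdFrac X c hc t ht z hz h) :=
  mk_stdFrac_eq_mk_stdFrac X hPf hc _ ht z hz _ h

/-- **`germ 1 = 1`.** [cite: MochizukiFrdI2008, Prop. 4.4 (i) p.84] -/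
theorem germ_one : germ X hPf hc 1 (one_mem _) = 1 :=
  mk_stdFrac_one X hPf hc _ _ _

/-- **`germ z · germ z' = germ (z · z')`** — the standard germs form a multiplicative family.
[cite: MochizukiFrdI2008, Prop. 4.4 (i) p.84] -/
theorem germ_mul (z z' : ℂˣ) (hz : z ∈ D0.scalars (frobPow hF X.obj c).fst.base)
    (hz' : z' ∈ D0.scalars (frobPow hF X.obj c).fst.base) :
    germ X hPf hc z hz * germ X hPf hc z' hz' = germ X hPf hc (z * z') (mul_mem hz hz') := by
  rw [germ, germ, mk_stdFrac_mul_mk_stdFrac X hPf hc (rad_le (frobPow hF X.obj c) z) (rad_le (frobPow hF X.obj c) z') z z' hz hz'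
    (norm_mul_rad_le (frobPow hF X.obj c) z) (norm_mul_rad_le (frobPow hF X.obj c) z') (rad₂_le_rad (frobPow hF X.obj c) z z') (norm_mul_rad₂_le_rad (frobPow hF X.obj c) z z')
    (rad₂_le (frobPow hF X.obj c) z z') (norm_mul_rad₂_le (frobPow hF X.obj c) z z')]
  exact (germ_eq_mk_stdFrac X hPf hc _ _ _ _ _).symm

/-- **The germ homomorphism `K^× →* O^×((A, n)^birat)`** of [FrdII] Thm. 3.6 (i) at `Λ = ℚ`: the rational
functions of `C^pf` at `X` coming from the scalars `K^×` of the base field of `A^{(c)}`.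
[cite: MochizukiFrdII2008, Thm 3.6 (i) p.36] -/
def germHom : D0.scalars (frobPow hF X.obj c).fst.base →* BiratUnits (pfStr π hF) hPf X where
  toFun z := germ X hPf hc (z : ℂˣ) z.2
  map_one' := germ_one X hPf hc
  map_mul' z z' := (germ_mul X hPf hc (z : ℂˣ) (z' : ℂˣ) z.2 z'.2).symm

/-- `germHom z = germ z`. [cite: MochizukiFrdII2008, Thm 3.6 (i) p.36] -/
@[simp] theorem germHom_apply (z : D0.scalars (frobPow hF X.obj c).fst.base) :
    germHom X hPf hc z = germ X hPf hc (z : ℂˣ) z.2 := rfl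


/-! ### Divisors of the standard germs ([FrdI] Prop. 4.4 (i)) -/

omit hPf in
/-- The pull-back maps of `Φ^pf` (the divisor monoid of `C^pf`) are identities, since those of `Φ = ℝ_{≥0}` are.
[cite: MochizukiFrdI2008, Prop. 3.2 (i) p.58] -/
theorem ops_pull_apply {E E' : D} (f : E' ⟶ E) (x : (Perfection.ops hF).Mon E) :
    (Perfection.ops hF).pull f x = x := by
  change Frobenioids.Perfection.map (pull (Φ π) f) x = x
  obtain ⟨⟨a, n⟩, rfl⟩ := Frobenioids.Perfection.mk_surjective x
  exact Frobenioids.Perfection.map_mk _ a n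

omit hPf in
/-- **The perfected divisor of the arrow of `C^pf` induced by `ι : disc → A^{(c)}`** is the class of `Div(ι)` at
index `n·c` (Prop. 3.2 (i): `Div([φ′]) = (frob^* Div φ′)^{1/(n·a)}`; here `a = 1` and `frob_disc⁻¹` is an
isometry). [cite: MochizukiFrdI2008, Prop. 3.2 (i) p.58] -/
theorem div_inclHom (t : PosReal) (ι : disc (frobPow hF X.obj c) t ⟶ frobPow hF X.obj c) :
    PreFrobenioid.Div (pfStr π hF) (inclHom X c t ι) =
      Frobenioids.Perfection.mk (PreFrobenioid.Div (C.toElem π) ι) (X.idx * c * 1) := by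
  haveI := Perfection.isIso_frob_one (hF := hF) (disc (frobPow hF X.obj c) t)
  have hiso : PreFrobenioid.Div (C.toElem π) (frobOneInv (hF := hF) (disc (frobPow hF X.obj c) t)) = 1 :=
    PreFrobenioid.isIsometry_of_isIso (C.toElem π) hF.isPreFrobenioid (inv (frob hF (disc (frobPow hF X.obj c) t) 1))
  change Rep.div (inclRep X c t ι) = _
  unfold Rep.div inclRep
  dsimp only
  rw [pull_Φ, PreFrobenioid.div_comp, pull_Φ, hiso, one_pow, mul_one]

omit hPf in
/-- `(ψ^*)⁻¹ Div ψ = Div ψ` in `C^pf` over the archimedean base (all pull-backs are identities).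
[cite: MochizukiFrdI2008, Def. 1.3 (iii) p.25] -/
theorem invDiv_pfStr {Y Z : pfCat π hF} (ψ : Y ⟶ Z) (h : PreFrobenioid.IsBaseIso (pfStr π hF) ψ) :
    PreFrobenioid.invDiv (pfStr π hF) ψ h = PreFrobenioid.Div (pfStr π hF) ψ :=
  ops_pull_apply (hF := hF) _ _

omit hPf in
/-- The class of `a ∈ Φ = ℝ_{≥0}` at index `N` in `Φ^pf(Base X)^gp = Φ^gp((A, n))` ("`a^{1/N}`").
[cite: MochizukiFrdI2008, Prop. 3.2 (i) p.58] -/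
def phiGpMk (a : Multiplicative ℝ≥0) (N : ℕ+) : PhiGp (pfStr π hF) X :=
  Algebra.GrothendieckGroup.of (Frobenioids.Perfection.mk (M := (Φ π).obj (op X.obj.snd)) a N)

/-- **The divisor of the standard germ of scalar `z`** ([FrdI] Prop. 4.4 (i): `[(α, φ)] ↦ (φ^*)⁻¹Div φ − (α^*)⁻¹Div α`):
the quotient of the perfected classes, at index `n·c`, of `Div` of the scalar arrows with scalars `z` and `1` —
i.e. of `log(tip/(|z|·t))` and `log(tip/t)` (Ex. 3.3 (i) p. 28; `toAdd_div_discIncl`), a net `−log |z|`.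
[cite: MochizukiFrdI2008, Prop. 4.4 (i) p.84] -/
theorem divHom_germ (z : ℂˣ) (hz : z ∈ D0.scalars (frobPow hF X.obj c).fst.base) :
    BiratUnits.divHom hPf X (germ X hPf hc z hz) =
      phiGpMk X (C0.div (discIncl (frobPow hF X.obj c) hc (rad (frobPow hF X.obj c) z) z hz (norm_mul_rad_le (frobPow hF X.obj c) z)).fst)
          (X.idx * c * 1) /
        phiGpMk X (C0.div (discIncl (frobPow hF X.obj c) hc (rad (frobPow hF X.obj c) z) 1 (one_mem _)
          (norm_one_mul_le (rad_le (frobPow hF X.obj c) z))).fst) (X.idx * c * 1) := by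
  rw [germ, BiratUnits.divHom_mk]
  unfold RatFrac.div
  rw [invDiv_pfStr, invDiv_pfStr]
  change Algebra.GrothendieckGroup.of (PreFrobenioid.Div (pfStr π hF) (inclHom X c _ _)) /
      Algebra.GrothendieckGroup.of (PreFrobenioid.Div (pfStr π hF) (inclHom X c _ _)) = _
  rw [div_inclHom, div_inclHom]
  rfl

end Std

end Germs

end Thm36Sub

end ArchFrd

end Literature.AlgebraicGeometry.Frobenioids

end
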